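import Literature.Probability.LatticeModels.MedialCycleSeparation
import HarnessLib

/-!
# Touch criterion: the two half-diagonal computations for the closed polygon of a cycle

Topic: `Summits/CriticalPhenomena/CardyFormulaZ2`. For the crux `LagHandOff` (line
hitting-tournament, cluster-form touch criterion), two facts read off the proof of
`medialCycle_separates_holds` (`Literature/Probability/LatticeModels/MedialCycleSeparation.lean`)
for the closed perturbed polygon `cyLoop n h` of a cycle of the turning rule of period `n + 1`
through a corner `q`:
* (A3) if the period is minimal, the polygon crosses the half-diagonal from the vertex `q.1`
  into the face `cFace q` exactly once, transversally (by its first dart piece), so the winding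
  numbers of `q.1` and of the centre of `cFace q` differ;
* (A4) for a corner `(v, k)` off the cycle, the polygon misses the half-diagonal from `v` into
  `faceAt v k`, so `v` and the centre of `faceAt v k` have the same winding number.
-/

noncomputable section

open Set Complex Literature.Topology.PlaneTopology
open Literature.Probability.Percolation Literature.Probability.LatticeModels

namespace Summit.CriticalPhenomena.CardyFormulaZ2.Cruxes.LagHandOff.HittingTournament

/-- The source and target directions of a dart are `(0, 1)` or `(1, 0)`. -/
theorem srcDir_tgtDir_cases (v f : Site 2) :
    (srcDir v f = 0 ∧ tgtDir v f = 1) ∨ (srcDir v f = 1 ∧ tgtDir v f = 0) := by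
  unfold srcDir tgtDir; split_ifs <;> simp

/-- **The crossing defect of the closed polygon of a minimal cycle relative to the half-diagonal
of its base corner is nonzero**: all dart pieces but the first and all connectors miss the
half-diagonal `[q.1, centre (cFace q)]` (a dart piece meeting it would be the dart of `q`,
excluded by minimality; connectors miss half-diagonals), and the first dart piece crosses it
transversally (`crossInc_dartSeg_ne_zero`, read in one of its two orientations). -/
theorem crossInc_cyLoop_halfDiag_ne_zero (β : BondConfig (Site 2)) (q : Site 2 × Fin 4) (n : ℕ)
    (h : cornerOrbit β q (n + 1) = q) (hmin : ∀ j, 1 ≤ j → j ≤ n → cornerOrbit β q j ≠ q) :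
    (cyLoop n h).crossInc (Site.toComplex q.1) (faceCenter (cFace q)) ≠ 0 := by
  have hhalf : halfDiag q.1 (faceAt q.1 q.2) = segment ℝ (Site.toComplex q.1) (faceCenter (cFace q)) :=
    rfl
  have hd : ∀ j, 1 ≤ j → j ≤ n → ∀ z ∈ cyDart β q j,
      z ∉ segment ℝ (Site.toComplex q.1) (faceCenter (cFace q)) := by
    intro j hj1 hjn z hz hz'
    rw [← hhalf] at hz'
    exact hmin j hj1 hjn ((cy_eq_of_mem_halfDiag j hz hz').trans (Prod.ext rfl rfl))
  have hc : ∀ j ≤ n, ∀ z ∈ cyConn β q j, z ∉ segment ℝ (Site.toComplex q.1) (faceCenter (cFace q)) := by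
    intro j _ z hz hz'
    rw [← hhalf] at hz'
    exact cyConn_disjoint_halfDiag j (isCorner_faceAt q.1 q.2) hz hz'
  rw [crossInc_cyLoop_eq n h hd hc (toComplex_not_mem_cyDart _ _) (faceCenter_not_mem_cyDart _ _)]
  -- the first dart piece is `dartSeg q.1 (cFace q)`, read in one of its two orientations
  have key := crossInc_dartSeg_ne_zero (isCorner_faceAt q.1 q.2)
  rcases srcDir_tgtDir_cases (cyV β q 0) (cyF β q 0) with ⟨h0, h1⟩ | ⟨h0, h1⟩
  · rw [cyS, cyT, h0, h1]; exact key
  · rw [cyS, cyT, h0, h1, ← Path.segment_symm, Path.crossInc_symm]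
    · exact neg_ne_zero.2 key
    · rw [Path.range_segment]; exact fun h' => toComplex_not_mem_dartSeg (isCorner_faceAt q.1 q.2) h'
    · rw [Path.range_segment]; exact fun h' => faceCenter_not_mem_dartSeg (isCorner_faceAt q.1 q.2) h'

/-- **A3: a minimal cycle separates the vertex of its base corner from the centre of its face.**
For a cycle of the turning rule of minimal period `n + 1` through `q`, the winding numbers of the
closed perturbed polygon `cyLoop n h` around the vertex `q.1` and around the centre of the face
`cFace q` differ: both points are off the polygon, and the crossing defect of the loop relative
to `[q.1, centre]`, which is `2πi` times the difference of the two winding numbers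
(`Path.crossInc_loop`), is nonzero (`crossInc_cyLoop_halfDiag_ne_zero`). -/
theorem stub_touch_wind_vertex_ne_faceCenter :
    ∀ (β : BondConfig (Site 2)) (q : Site 2 × Fin 4) (n : ℕ) (h : cornerOrbit β q (n + 1) = q),
      (∀ j, 1 ≤ j → j ≤ n → cornerOrbit β q j ≠ q) →
      wind (fun t => (cyLoop n h).extend t - Site.toComplex q.1) ≠
        wind (fun t => (cyLoop n h).extend t - faceCenter (cFace q)) := by
  intro β q n h hmin hw
  have hℓ : Site.toComplex q.1 ∉ range (cyLoop n h) :=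
    not_mem_range_cyLoop h (fun j _ => toComplex_not_mem_cyDart _ _) (fun j _ => toComplex_not_mem_cyConn _ _)
  have hr : faceCenter (cFace q) ∉ range (cyLoop n h) :=
    not_mem_range_cyLoop h (fun j _ => faceCenter_not_mem_cyDart _ _) (fun j _ => faceCenter_not_mem_cyConn _ _)
  have hcross := crossInc_cyLoop_halfDiag_ne_zero β q n h hmin
  rw [Path.crossInc_loop _ hℓ hr, hw, sub_self, zero_mul] at hcross
  exact hcross rfl

/-- **A4: a corner off the cycle has vertex and face centre with the same winding number.** If
no corner `cornerOrbit β q j`, `j ≤ n`, of the cycle equals `(v, k)`, then the half-diagonal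
`[v, centre (faceAt v k)]` misses every dart piece (a dart piece meeting it would be the dart of
`(v, k)`, `cy_eq_of_mem_halfDiag`) and every connector (`cyConn_disjoint_halfDiag`) of the closed
perturbed polygon, so its endpoints have the same winding number (`wind_cyLoop_eq_of_segment`). -/
theorem stub_touch_wind_vertex_eq_faceCenter_of_not_mem :
    ∀ (β : BondConfig (Site 2)) (q : Site 2 × Fin 4) (n : ℕ) (h : cornerOrbit β q (n + 1) = q)
      (v : Site 2) (k : Fin 4), (∀ j ≤ n, cornerOrbit β q j ≠ (v, k)) →
      wind (fun t => (cyLoop n h).extend t - Site.toComplex v) =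
        wind (fun t => (cyLoop n h).extend t - faceCenter (faceAt v k)) := by
  intro β q n h v k hoff
  have hhalf : halfDiag v (faceAt v k) = segment ℝ (Site.toComplex v) (faceCenter (faceAt v k)) := rfl
  refine wind_cyLoop_eq_of_segment h fun z hz => not_mem_range_cyLoop h (fun j hj hzj => ?_) (fun j hj hzj => ?_)
  · rw [← hhalf] at hz
    exact hoff j hj (cy_eq_of_mem_halfDiag j hzj hz)
  · rw [← hhalf] at hz
    exact cyConn_disjoint_halfDiag j (isCorner_faceAt v k) hzj hz

end Summit.CriticalPhenomena.CardyFormulaZ2.Cruxes.LagHandOff.HittingTournament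

end
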